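import Summits.AtomisticToContinuum.BoseEinsteinCondensation.Theses.BECRieszReverseHolder

/-!
# AtomisticToContinuum / BoseEinsteinCondensation — route `BECRieszReverseHolder`, assembly

Settles the assembly item `stmt-AtomisticToContinuum-12847` of route
`route-AtomisticToContinuum-BECRieszReverseHolder`: the implication
`CoarseGrainedReverseHolder → MicroscaleFlatness → TwoScaleGlue → GroundStateEnergyFinite →
GroundStateRigidity → PositiveNearMinimiserExists → OccupationStability → PositivityTransfer →
BoseEinsteinCondensation`.

The hypotheses of `Assembly` are, verbatim and in the same order, those of the route's deciding
theorem `closes`, so the assembly is that theorem curried; the composition is spelled out again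
below for the record: `TwoScaleGlue` turns the two slice cruxes `CoarseGrainedReverseHolder` and
`MicroscaleFlatness` into `PositiveZeroMode` (flat-mode occupation of non-negative near-minimisers);
`PositivityTransfer`, fed with the fixed-`N` frame `GroundStateEnergyFinite`, `GroundStateRigidity`,
`PositiveNearMinimiserExists`, `OccupationStability`, upgrades it to flat-mode occupation for all
near-minimisers (X_B1, the hypothesis of the proved
`AtomisticToContinuum.BECInfraredBound.bec_of_zeroMode`), which gives the sub-problem statement
`BoseEinsteinCondensation`. Pure logic; no analytic content lives here.
-/

namespace Summit.AtomisticToContinuum.BoseEinsteinCondensation.Theorems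

/-- Settles `stmt-AtomisticToContinuum-12847` (exact signature): the assembly of route
`BECRieszReverseHolder`, i.e. its eight items imply the sub-problem statement
`BoseEinsteinCondensation`. Proof: `bec_of_zeroMode` applied to X_B1, which `PositivityTransfer`
produces from the four frame items and `PositiveZeroMode = TwoScaleGlue CoarseGrainedReverseHolder
MicroscaleFlatness`. [folklore] -/
theorem becRieszReverseHolder_assembly_proof :
    Summit.AtomisticToContinuum.BoseEinsteinCondensation.Theses.BECRieszReverseHolder.Assembly := by
  unfold Theses.BECRieszReverseHolder.Assembly
  intro h₁ h₂ h₃ h₄ h₅ h₆ h₇ h₈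
  exact _root_.AtomisticToContinuum.BECInfraredBound.bec_of_zeroMode (h₈ h₄ h₅ h₆ h₇ (h₃ h₁ h₂))

end Summit.AtomisticToContinuum.BoseEinsteinCondensation.Theorems
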